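import Mathlib.Analysis.Matrix.PosDef
import Summits.RiemannHypothesis.RiemannHypothesis.Theorems.NymanBeurlingGramOneTwo
import Summits.RiemannHypothesis.RiemannHypothesis.Theorems.NymanBeurlingGramRhs
import HarnessLib

/-!
# RiemannHypothesis / Nyman–Beurling — the `N = 2` row of the DATA table EXACTLY (RH-FREE):
`d_2² = 1 − (G_{22} b_1² − 2 G_{12} b_1 b_2 + G_{11} b_2²)/(G_{11} G_{22} − G_{12}²)` in closed form

Column LI/NB of the RH ladder, rung L-P(P2) «structure of the NB minimiser», PROOF-OF-DATA for cell `pub/rh-li`.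
With the kernel values `G_{11} = log 2π − γ` (`nbGram_zero_zero`), `G_{22} = (log 2π − γ)/2` (`nbGram_diag`),
`G_{12} = ¾(log 2π − γ) − ¼ log 2` (`nbGram_zero_one`), `b_1 = 1 − γ` (`nbRhs_zero`), `b_2 = (log 2 + 1 − γ)/2`
(`nbRhs_eq`), the `2 × 2` normal equations are solved by Cramer's rule:

* `nbMinimiser_two`: `c⋆ = ((G_{22} b_1 − G_{12} b_2)/D, (G_{11} b_2 − G_{12} b_1)/D)`, `D = G_{11} G_{22} − G_{12}² > 0`
  (`RowTwo.det_two_pos`, from `nbGramMatrix_posDef`);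
* `nbDistSq_nbMinimiser_two`: `d_2² = 1 − (G_{22} b_1² − 2 G_{12} b_1 b_2 + G_{11} b_2²)/D`;
* `nbDistSq_nbMinimiser_two_closed`: the same with the five closed forms substituted —
  `d_2² = 0.28996457374220273181120058341604661120541…`, inside lineage R's certified interval
  `[0.289964573742202731811200583416046611205413, …414]` (kit j249067, HOME/data/nb_R_dN2_allN10000.tsv row `N = 2`):
  a second kernel-vs-Arb row, agreeing to 42 digits (50-digit evaluation in the seat, HOME/eng3/KERNEL-ROW-N1-eng3g3.md addendum).

RH-FREE [rh-li-eng-3]: `2 × 2` linear algebra over the kernel's closed forms; nothing here bears on the truth of RH.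
-/

noncomputable section

-- D-0017: `Summit.<S>.<S>.…` is the designed namespace of a single-problem summit.
set_option linter.dupNamespace false

open MeasureTheory Set Finset
open scoped Matrix

namespace Summit.RiemannHypothesis.RiemannHypothesis.Theorems.NbTheory

open Literature.NumberTheory.LFunctions Literature.NumberTheory.LFunctions.BaezDuarteOnlyIf
open GramPosDef Minimiser

namespace RowTwo

/-- `G_{21} = G_{12}`. -/
lemma nbGram_one_zero : nbGram 1 0 = nbGram 0 1 := by
  unfold nbGram; congr 1; funext x; ring

/-- `D = G_{11} G_{22} − G_{12}² > 0` (the `2 × 2` Gram determinant; `nbGramMatrix_posDef`). -/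
lemma det_two_pos : 0 < nbGram 0 0 * nbGram 1 1 - nbGram 0 1 ^ 2 := by
  have h := (nbGramMatrix_posDef 2).det_pos
  rw [Matrix.det_fin_two] at h
  simp only [nbGramMatrix, Matrix.of_apply, Fin.val_zero, Fin.val_one] at h
  rw [nbGram_one_zero] at h
  nlinarith

end RowTwo

open RowTwo

/-- **`N = 2`: the minimiser by Cramer's rule (RH-FREE).** -/
theorem nbMinimiser_two :
    nbMinimiser 2 =
      ![(nbGram 1 1 * nbRhs 0 - nbGram 0 1 * nbRhs 1) / (nbGram 0 0 * nbGram 1 1 - nbGram 0 1 ^ 2),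
        (nbGram 0 0 * nbRhs 1 - nbGram 0 1 * nbRhs 0) / (nbGram 0 0 * nbGram 1 1 - nbGram 0 1 ^ 2)] := by
  have hD := det_two_pos
  have hD1 : nbGram 0 0 * nbGram 1 1 - nbGram 0 1 ^ 2 ≠ 0 := hD.ne'
  have hD2 : -nbGram 0 1 ^ 2 + nbGram 1 1 * nbGram 0 0 ≠ 0 := by
    rw [show -nbGram 0 1 ^ 2 + nbGram 1 1 * nbGram 0 0 = nbGram 0 0 * nbGram 1 1 - nbGram 0 1 ^ 2 by ring]
    exact hD.ne'
  symm
  refine eq_nbMinimiser_of_normalEq fun k ↦ ?_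
  fin_cases k
  · simp only [Fin.sum_univ_two, Fin.isValue, Matrix.cons_val_zero, Matrix.cons_val_one, Fin.val_zero, Fin.val_one]
    show nbGram 0 0 * _ + nbGram 0 1 * _ = nbRhs 0
    rw [mul_div_assoc', mul_div_assoc', ← add_div, div_eq_iff hD1]
    ring
  · simp only [Fin.sum_univ_two, Fin.isValue, Matrix.cons_val_zero, Matrix.cons_val_one, Fin.val_one, Fin.val_zero]
    show nbGram 1 0 * _ + nbGram 1 1 * _ = nbRhs 1
    rw [nbGram_one_zero, mul_div_assoc', mul_div_assoc', ← add_div, div_eq_iff hD1]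
    ring

/-- **`N = 2`: `d_2² = 1 − (G_{22} b_1² − 2 G_{12} b_1 b_2 + G_{11} b_2²)/(G_{11} G_{22} − G_{12}²)` (RH-FREE).** -/
theorem nbDistSq_nbMinimiser_two :
    nbDistSq 2 (nbMinimiser 2) =
      1 - (nbGram 1 1 * nbRhs 0 ^ 2 - 2 * nbGram 0 1 * nbRhs 0 * nbRhs 1 + nbGram 0 0 * nbRhs 1 ^ 2) /
        (nbGram 0 0 * nbGram 1 1 - nbGram 0 1 ^ 2) := by
  have hD := det_two_pos
  rw [nbDistSq_nbMinimiser, Fin.sum_univ_two, nbMinimiser_two]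
  have hD1 : nbGram 0 0 * nbGram 1 1 - nbGram 0 1 ^ 2 ≠ 0 := hD.ne'
  simp only [Fin.isValue, Matrix.cons_val_zero, Matrix.cons_val_one, Fin.val_zero, Fin.val_one]
  show 1 - (_ * nbRhs 0 + _ * nbRhs 1) = _
  rw [div_mul_eq_mul_div, div_mul_eq_mul_div, ← add_div]
  congr 1
  rw [div_eq_div_iff hD1 hD1]
  ring

/-- **`N = 2` IN CLOSED FORM (RH-FREE):** with `α = log 2π − γ`, `ℓ = log 2`, `b_1 = 1 − γ`, `b_2 = (ℓ + 1 − γ)/2`,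
`G_{11} = α`, `G_{22} = α/2`, `G_{12} = ¾α − ¼ℓ`:
`d_2² = 1 − ((α/2) b_1² − 2(¾α − ¼ℓ) b_1 b_2 + α b_2²)/(α²/2 − (¾α − ¼ℓ)²)` (`= 0.2899645737422027318112005834160466112054…`,
lineage R's certified row `N = 2` to 42 digits). -/
theorem nbDistSq_nbMinimiser_two_closed :
    nbDistSq 2 (nbMinimiser 2) =
      1 - ((Real.log (2 * Real.pi) - Real.eulerMascheroniConstant) / 2 * (1 - Real.eulerMascheroniConstant) ^ 2
            - 2 * (3 / 4 * (Real.log (2 * Real.pi) - Real.eulerMascheroniConstant) - Real.log 2 / 4)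
                * (1 - Real.eulerMascheroniConstant) * ((Real.log 2 + 1 - Real.eulerMascheroniConstant) / 2)
            + (Real.log (2 * Real.pi) - Real.eulerMascheroniConstant)
                * ((Real.log 2 + 1 - Real.eulerMascheroniConstant) / 2) ^ 2) /
          ((Real.log (2 * Real.pi) - Real.eulerMascheroniConstant)
              * ((Real.log (2 * Real.pi) - Real.eulerMascheroniConstant) / 2)
            - (3 / 4 * (Real.log (2 * Real.pi) - Real.eulerMascheroniConstant) - Real.log 2 / 4) ^ 2) := by
  rw [nbDistSq_nbMinimiser_two, nbGram_zero_zero, nbGram_zero_one, nbGram_diag 1, nbRhs_zero, nbRhs_eq 1]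
  norm_num

end Summit.RiemannHypothesis.RiemannHypothesis.Theorems.NbTheory

end
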